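import Summits.HodgeConjecture.HodgeConjecture.Theses.NoetherLefschetzOneUp
import Literature.AlgebraicGeometry.HodgeTheory.FibreRestrictionsLocallyConstantRank
import Literature.AlgebraicGeometry.Motives.FiberNetSmoothFibres
import HarnessLib

/-!
# `stub_fibreClassTransport` — fibre-triviality of a global class is transported along a smooth open

Registered stub `stub_fibreClassTransport` (S2b) of line `registered` of crux `K3TypeNets`
(stmt-HodgeConjecture-11600, route `NoetherLefschetzOneUp` of `HodgeConjecture`); this file SUPPORTS
the crux, it does not close it.

STATEMENT. Let `X` be a smooth projective complex fourfold and `f : X ⟶ ℙ²_ℂ` a morphism with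
geometrically connected fibres which is smooth of relative dimension two wherever it is smooth (so
that `(X, 𝟙, f)` is the tautological surface net `SurfaceNet.ofFibration`), `U ⊆ ℙ²` an open over
which `f` is smooth, and `c ∈ H⁴(X(ℂ); ℂ)`. If `c|_{X_{s₀}} = 0` for ONE `ℂ`-point `s₀` of `U`, then
`c|_{X_s} = 0` for EVERY `ℂ`-point `s` of `U`.

PROOF (Ehresmann half of the Leray edge; Voisin I §9.2.1 with Thm. 9.3, SGA1 XII Prop. 2.4).
`U` lies in the smooth base `ℙ² ∖ Δ` of the net (maximality of the smooth locus,
`FiberNet.le_smoothBase_of_smooth`). Over the `ℂ`-points of the smooth base, `f(ℂ)` is topologically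
locally trivial (Ehresmann on complex points for the proper family smooth over the smooth base,
`FiberNet.exists_trivialisation_smoothBase`), the base `ℙ²(ℂ)` has small contractible opens (chart
balls of the `4`-manifold `ℙ²(ℂ)`), hence `f` is homotopically and so cohomologically locally
trivial there (`isHomotopicallyLocallyTrivialOn_of_trivialisations`, homotopy invariance): the
restrictions `s ↦ c|_{X_s}` are a flat section of the local system `R⁴f_*ℂ` over the smooth base
(`FibreRestrictionsLocallyConstantRank`). The `ℂ`-points of the smooth base form a connected set
(an open of the irreducible `ℙ²`, `FiberNet.isConnected_setOf_pt_mem_smoothBase`), and a flat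
section vanishing at one point of a connected locus vanishes identically
(`map_fiberι_ne_zero_of_isPreconnected`). Since both `s₀` and `s` lie over `U ⊆ ℙ² ∖ Δ`, the claim
follows. Everything used is proved in the tree; no named fact, no `sorry`.

## References

* [VoisinHodgeI2002] C. Voisin, *Hodge Theory and Complex Algebraic Geometry I* (2002), Thm. 9.3,
  §9.2.1.
* [VoisinHodgeII2003] C. Voisin, *Hodge Theory and Complex Algebraic Geometry II* (2003), §3.1.1.
* [SGA1] A. Grothendieck, M. Raynaud, SGA 1, Exp. XII Prop. 2.4.
-/

-- `Summit.HodgeConjecture.HodgeConjecture.Theorems` is the mandated namespace (single-problem summit),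
-- flagged by `linter.dupNamespace`; the lakefile turns the linter off tree-wide, restated here.
set_option linter.dupNamespace false

noncomputable section

open CategoryTheory AlgebraicGeometry
open _root_.Topology _root_.Filter
open Literature.AlgebraicGeometry.Motives Literature.AlgebraicGeometry.HodgeTheory

namespace Summit.HodgeConjecture.HodgeConjecture.Theorems

/-- **`R^k π_* ℂ` of a net is a local system over the complex points of the smooth base.** For a net
of `r`-folds `N` on `X` over `ℙᵐ_ℂ` (`π = N.proj : X̃ ⟶ ℙᵐ`), `π` is cohomologically locally trivial
(by restriction, `IsCohomologicallyLocallyTrivialOn`) over `{t ∈ ℙᵐ(ℂ) | t ∈ ℙᵐ ∖ Δ}`: Ehresmann's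
theorem on complex points trivialises `π(ℂ)` near every such `t`
(`FiberNet.exists_trivialisation_smoothBase`), `ℙᵐ(ℂ)` is a topological `2m`-manifold with small
contractible opens, so every fibre inclusion into a small tube is a homotopy equivalence
(`isHomotopicallyLocallyTrivialOn_of_trivialisations`) and restriction from small tubes to fibres is
bijective on cohomology (Voisin I §9.2.1: "as `B` is locally contractible, `Hᵏ(X₀ × B₀, A) ≅ Hᵏ(X₀, A)`
… we deduce that `Rᵏ π_* A` is a local system"). [cite: VoisinHodgeI2002, §9.2.1 (with Thm. 9.3)] -/
theorem fiberNet_isCohomologicallyLocallyTrivialOn_smoothBase {r m : ℕ} {X : SchemeOver ℂ}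
    (N : FiberNet r m X) :
    IsCohomologicallyLocallyTrivialOn N.proj
      {t : ComplexPoints (projectiveSpace m ℂ) | t.pt ∈ N.smoothBase} := by
  haveI : IsProper N.proj.left := N.isProper_proj
  haveI : IsProper N.total.hom := N.isProper_total_hom
  haveI : IsSeparated N.total.hom := inferInstance
  haveI : SmoothOfRelativeDimension m (projectiveSpace m ℂ).hom :=
    (isSmoothProjective_projectiveSpace_holds ℂ m).smoothOfRelativeDimension
  haveI : Smooth (projectiveSpace m ℂ).hom := SmoothOfRelativeDimension.smooth m _
  haveI : LocallyOfFiniteType (projectiveSpace m ℂ).hom := inferInstance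
  letI := ComplexPoints.chartedSpace (projectiveSpace m ℂ) m
  exact (isHomotopicallyLocallyTrivialOn_of_trivialisations N.proj
    (fun t _ W hW ↦ exists_isOpen_contractibleSpace_of_chartedSpace (d := 2 * m) t W hW)
    (fun t ht ↦ N.exists_trivialisation_smoothBase t ht)).isCohomologicallyLocallyTrivialOn

/-- **Stub S2b — fibre-triviality is transported along a smooth open** (Ehresmann). For `X` smooth
projective of dimension `4`, `f : X ⟶ ℙ²_ℂ` with geometrically connected fibres and of relative
dimension two where smooth, an open `U ⊆ ℙ²` with `Smooth (f.left ∣_ U)`, a class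
`c ∈ H⁴(X(ℂ); ℂ)` and `ℂ`-points `s₀, s` of `U`: if `c|_{X_{s₀}} = 0` then `c|_{X_s} = 0`. Proof:
`U` lies in the smooth base of the tautological surface net `SurfaceNet.ofFibration`
(`FiberNet.le_smoothBase_of_smooth`); over the `ℂ`-points of the smooth base the restrictions
`t ↦ c|_{X_t}` form a flat section of the local system `R⁴f_*ℂ`
(`fiberNet_isCohomologicallyLocallyTrivialOn_smoothBase`), that locus is connected
(`FiberNet.isConnected_setOf_pt_mem_smoothBase`, SGA1 XII Prop. 2.4), and a flat section vanishing at
one point of a connected locus vanishes (`map_fiberι_ne_zero_of_isPreconnected`).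
[cite: VoisinHodgeI2002, §9.2.1 and Thm. 9.3] [cite: VoisinHodgeII2003, §3.1.1]
[cite: SGA1, Exp. XII Prop. 2.4] -/
theorem stub_fibreClassTransport :
    ∀ ⦃X : SchemeOver ℂ⦄ (f : X ⟶ projectiveSpace 2 ℂ), IsSmoothProjective 4 X →
      GeometricallyConnected f.left →
      (∀ U : (projectiveSpace 2 ℂ).left.Opens,
        Smooth (f.left ∣_ U) → SmoothOfRelativeDimension 2 (f.left ∣_ U)) →
      ∀ U : (projectiveSpace 2 ℂ).left.Opens, Smooth (f.left ∣_ U) →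
        ∀ c : complexBetti X (2 * 2), ∀ s₀ s : AlgPoints (projectiveSpace 2 ℂ) ℂ,
          s₀.pt ∈ U → s.pt ∈ U →
          complexBetti.map (fiberι f s₀) (2 * 2) c = 0 →
          complexBetti.map (fiberι f s) (2 * 2) c = 0 := by
  intro X f hX hconn hrel U hU c s₀ s hs₀ hs h₀
  -- the tautological surface net `N = (X, 𝟙, f)` (`N.total = X`, `N.proj = f` by `rfl`)
  haveI := hconn
  let N : SurfaceNet 2 X := SurfaceNet.ofFibration (m := 2) hX f hrel
  -- `U` lies in the smooth base `ℙ² ∖ Δ`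
  have hUle : U ≤ N.smoothBase := N.le_smoothBase_of_smooth U hU
  have hs₀' : s₀.pt ∈ N.smoothBase := hUle hs₀
  have hs' : s.pt ∈ N.smoothBase := hUle hs
  -- `R⁴ f_* ℂ` is a local system over the connected locus of `ℂ`-points of the smooth base
  have hlt : IsCohomologicallyLocallyTrivialOn f
      {t : ComplexPoints (projectiveSpace 2 ℂ) | t.pt ∈ N.smoothBase} :=
    fiberNet_isCohomologicallyLocallyTrivialOn_smoothBase N
  have hconn' : IsPreconnected
      {t : ComplexPoints (projectiveSpace 2 ℂ) | t.pt ∈ N.smoothBase} :=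
    (N.isConnected_setOf_pt_mem_smoothBase ⟨s₀.pt, hs₀'⟩).isPreconnected
  -- a flat section vanishing at `s₀` vanishes at `s`
  by_contra hne
  exact map_fiberι_ne_zero_of_isPreconnected hlt hconn' c hs' hs₀' hne h₀

end Summit.HodgeConjecture.HodgeConjecture.Theorems

end
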